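import Summits.QuantumFields.BalabanUV.T4Continuum.Support.CovariantMeanRecursion

/-!
# `T4Continuum.CovariantMeanBirthLedger` (cell-tree module `Summits/QuantumFields/BalabanUV/T4Continuum/Support/CovariantMeanBirthLedger.lean`)
# — road P4 of the spine estimate NE1′, tangent-map formulation (v2): THE LEDGER OF BORN CORRECTIONS — what the insertion
# lemma IL must deliver for the recursion REC to close, as real bookkeeping: if the corrections born at level `j+1` have total
# class norm `y (j+1) ≤ ε · x j`, where `x j = C·Σ_{i≤j} r^{j−i}·y i` is the total DEPTH VALUE at level `j` of everything born
# so far (each piece gaining `C·r^{age}` by the depth lemma), then `x` satisfies the hypothesis of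
# `CovariantMeanRecursion.le_geometric_of_recursion` and decays geometrically at the rate `r(1+η)`; and the NECESSITY side
# (skeleton v2.4 risk R-P4-9): corrections that do not themselves gain depth leave a floor `x j ≥ c > 0`, and a floor is
# not summable against the per-level count `L ≥ 1`
# (cell `pub-balaban`, sub-cell `t4`, ROUND-2 prover seat #4 of BINDER-OWNERS row NE1′, unit `b2b-balaban-t4-ne1p-p4`,
# generation 3; companion of the HOME record `t4/b2b-balaban-t4-ne1p-p4/PROPAGATION-v2.md` §4.4, §7.2 and of the skeleton
# `t4/skeletons/NE1p-t4-ne1p-p4.md` v2.4 leaves L8-IL / L8-REC and risk R-P4-9; ADDITIVE — imports its sibling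
# `Support.CovariantMeanRecursion` (p209931) only; nothing modified)

HONEST FRAMING.  Finite four-torus, rung (B)+1 only.  NOT infinite volume, NOT a mass gap, NOT the Clay problem, NOT summit
progress.  HONEST DEPENDENCY: continuum YM on T⁴ ⇐ BetaPertH ∧ nine spine estimates (0/9 proved); BetaPertH ⇐ (D1) ∧ (D4) ∧
CAP+tail; G-an2-4 gates asym, D1 and NE2/3/4.  This module is PURE REAL ARITHMETIC (finite sums); it asserts nothing about
T. Bałaban's densities; every declaration is [folklore] and sorry-free.

DICTIONARY (where the road uses it; record §4.4 / §7.2).  Index `0` = the birth level `b` of a first-order member; `y 0` = the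
class norm of the birth functional; `y i` (`i ≥ 1`) = the total class norm of the corrections BORN at level `b+i` (they are class
members of the level-`(b+i)` class — that is the LOCALITY half IL-loc of the insertion lemma); `C·r^{j−i}` = the depth gain of a
piece of age `j − i` (the depth lemma DL, tree `CovariantMeanLatticeDisc` / `CovariantMeanLatticeDepth`); `x j = depthTotal C r y j`
= the resulting bound on the total depth value at level `b+j`; the hypothesis `y (j+1) ≤ ε·x j` = the ANALYTIC half IL-an (the
class norm of a correction is `ε` times the DEPTH VALUE of its parent, because the one-step block integral at regular data only
evaluates the parent at regular configurations); `ε` = `ε_fl`.  None of these identifications is made here.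

CITATION HEADER (lean-in-tree rule).  No page of the series (CMP 1983–89) or of any other source is quoted or attributed here.
Objects re-used BY NAME: `CovariantMeanRecursion.le_geometric_of_recursion` (this seat, p209931).
-/

noncomputable section

open Finset

namespace Summit.QuantumFields.BalabanUV.T4Continuum.CovariantMeanBirthLedger

/-! ## §1 The ledger: total depth value of everything born so far -/

/-- Total depth value at (relative) level `j`: every generation `i ≤ j` of born pieces, of total class norm `y i`, contributes
with its own depth factor `C·r^{j−i}`. [folklore] -/
def depthTotal (C r : ℝ) (y : ℕ → ℝ) (j : ℕ) : ℝ := C * ∑ i ∈ range (j + 1), r ^ (j - i) * y i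

/-- At the birth level only the birth functional is on the ledger: `x 0 = C·y 0`. [folklore] -/
theorem depthTotal_zero (C r : ℝ) (y : ℕ → ℝ) : depthTotal C r y 0 = C * y 0 := by
  simp [depthTotal]

/-- The ledger is non-negative for non-negative data. [folklore] -/
theorem depthTotal_nonneg {C r : ℝ} {y : ℕ → ℝ} (hC : 0 ≤ C) (hr : 0 ≤ r) (hy : ∀ i, 0 ≤ y i) (j : ℕ) :
    0 ≤ depthTotal C r y j := by
  unfold depthTotal
  exact mul_nonneg hC (sum_nonneg fun i _ => mul_nonneg (pow_nonneg hr _) (hy i))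

/-- Splitting off the birth term and re-indexing the born generations:
`x j = C·r^j·y 0 + C·Σ_{i<j} r^{j−1−i}·y (i+1)`. [folklore] -/
theorem depthTotal_split (C r : ℝ) (y : ℕ → ℝ) (j : ℕ) :
    depthTotal C r y j = C * r ^ j * y 0 + C * ∑ i ∈ range j, r ^ (j - 1 - i) * y (i + 1) := by
  unfold depthTotal
  rw [sum_range_succ', Nat.sub_zero]
  have e : ∀ i ∈ range j, r ^ (j - (i + 1)) * y (i + 1) = r ^ (j - 1 - i) * y (i + 1) := by
    intro i _
    have : j - (i + 1) = j - 1 - i := by omega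
    rw [this]
  rw [sum_congr rfl e]
  ring

/-- One generation against the ledger: the birth term alone gives `C·r^j·y 0 ≤ C·r^j·x 0` (`C ≥ 1`). [folklore] -/
theorem birth_le {C r : ℝ} {y : ℕ → ℝ} (hC : 1 ≤ C) (hr : 0 ≤ r) (hy0 : 0 ≤ y 0) (j : ℕ) :
    C * r ^ j * y 0 ≤ C * r ^ j * depthTotal C r y 0 := by
  rw [depthTotal_zero]
  have h1 : y 0 ≤ C * y 0 := by nlinarith
  exact mul_le_mul_of_nonneg_left h1 (by positivity)

/-- **THE LEDGER RECURSION.**  If every generation of corrections is bounded by `ε` times the previous level's total depth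
value — `y (j+1) ≤ ε · x j` (the insertion lemma, both halves) — then the ledger satisfies the hypothesis of the recursion lemma:
`x j ≤ C·r^j·x 0 + C·ε·Σ_{i<j} r^{j−1−i}·x i` for every `j ≥ 1`. [folklore] -/
theorem depthTotal_recursion {C r ε : ℝ} {y : ℕ → ℝ} (hC : 1 ≤ C) (hr : 0 ≤ r) (hy0 : 0 ≤ y 0)
    (hIL : ∀ j, y (j + 1) ≤ ε * depthTotal C r y j) (j : ℕ) :
    depthTotal C r y j ≤ C * r ^ j * depthTotal C r y 0 +
      C * ε * ∑ i ∈ range j, r ^ (j - 1 - i) * depthTotal C r y i := by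
  rw [depthTotal_split C r y j]
  have hC0 : 0 ≤ C := zero_le_one.trans hC
  have hgen : C * ∑ i ∈ range j, r ^ (j - 1 - i) * y (i + 1) ≤
      C * ε * ∑ i ∈ range j, r ^ (j - 1 - i) * depthTotal C r y i := by
    have hstep : ∀ i ∈ range j, r ^ (j - 1 - i) * y (i + 1) ≤ r ^ (j - 1 - i) * (ε * depthTotal C r y i) :=
      fun i _ => mul_le_mul_of_nonneg_left (hIL i) (pow_nonneg hr _)
    calc C * ∑ i ∈ range j, r ^ (j - 1 - i) * y (i + 1)
        ≤ C * ∑ i ∈ range j, r ^ (j - 1 - i) * (ε * depthTotal C r y i) :=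
          mul_le_mul_of_nonneg_left (sum_le_sum hstep) hC0
      _ = C * ε * ∑ i ∈ range j, r ^ (j - 1 - i) * depthTotal C r y i := by
          have hs : ∑ i ∈ range j, r ^ (j - 1 - i) * (ε * depthTotal C r y i) =
              ε * ∑ i ∈ range j, r ^ (j - 1 - i) * depthTotal C r y i := by
            rw [Finset.mul_sum]
            exact sum_congr rfl fun i _ => by ring
          rw [hs]; ring
  have hb := birth_le hC hr hy0 j (r := r) (y := y)
  linarith

/-- **THE LEDGER DECAYS GEOMETRICALLY.**  Under the ledger recursion with `C ≥ 1`, `r > 0`, `η > 0`, `0 ≤ ε ≤ rη/(2C)` and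
non-negative generations, the total depth value decays at the rate `r(1+η)` with the constant paid once:
`x j ≤ 2C·(r(1+η))^j·x 0 = 2C²·(r(1+η))^j·y 0`. [folklore] -/
theorem depthTotal_le_geometric {C r η ε : ℝ} {y : ℕ → ℝ} (hC : 1 ≤ C) (hr : 0 < r) (hη : 0 < η) (hε0 : 0 ≤ ε)
    (hε : ε ≤ r * η / (2 * C)) (hy : ∀ i, 0 ≤ y i) (hIL : ∀ j, y (j + 1) ≤ ε * depthTotal C r y j) (j : ℕ) :
    depthTotal C r y j ≤ 2 * C * (r * (1 + η)) ^ j * (C * y 0) := by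
  have hx0 : 0 ≤ depthTotal C r y 0 := depthTotal_nonneg (zero_le_one.trans hC) hr.le hy 0
  have h := CovariantMeanRecursion.le_geometric_of_recursion (x := depthTotal C r y) hC hr hη hε0 hε hx0
    (fun j _ => depthTotal_recursion hC hr.le (hy 0) hIL j) j
  rwa [depthTotal_zero] at h

/-- … hence every generation of corrections is itself geometrically small: `y (j+1) ≤ ε·2C²·(r(1+η))^j·y 0`. [folklore] -/
theorem generation_le_geometric {C r η ε : ℝ} {y : ℕ → ℝ} (hC : 1 ≤ C) (hr : 0 < r) (hη : 0 < η) (hε0 : 0 ≤ ε)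
    (hε : ε ≤ r * η / (2 * C)) (hy : ∀ i, 0 ≤ y i) (hIL : ∀ j, y (j + 1) ≤ ε * depthTotal C r y j) (j : ℕ) :
    y (j + 1) ≤ ε * (2 * C * (r * (1 + η)) ^ j * (C * y 0)) :=
  (hIL j).trans (mul_le_mul_of_nonneg_left (depthTotal_le_geometric hC hr hη hε0 hε hy hIL j) hε0)

/-! ## §2 The necessity side (risk R-P4-9): corrections that do not gain depth leave a floor, and a floor is not summable -/

/-- THE FLOOR.  If the first generation of corrections is booked at its class norm WITHOUT depth gain at the later levels (a
ledger `x' j ≥ y 1` for all `j ≥ 1`) and it is non-trivial (`y 1 = ε·x' 0 > 0`), then the ledger never drops below the floor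
`ε·x' 0`. (Trivial, recorded for the shape of the argument.) [folklore] -/
theorem floor_of_no_gain {x' y : ℕ → ℝ} {ε : ℝ} (h1 : y 1 = ε * x' 0) (hfloor : ∀ j, 1 ≤ j → y 1 ≤ x' j) {j : ℕ}
    (hj : 1 ≤ j) : ε * x' 0 ≤ x' j := by
  rw [← h1]; exact hfloor j hj

/-- A FLOOR IS NOT SUMMABLE AGAINST THE COUNT: if `c > 0`, `L ≥ 1` and `x j ≥ c` for every `j ≥ 1`, then `Σ_j L^j·x j`
diverges (the terms do not tend to zero).  On the road `L^j = Λ₄^j·θ₁^j = L^{4j}·L^{−3j}` is count × pushforward per level,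
and `c = ε·x 0` is the floor left by a per-level correction that does not itself gain depth: however small `ε > 0`, the
first-order defect series diverges — so the corrections MUST be class members gaining depth (IL-loc), or approximately so
(IL-dec with the offset form of the gain). [folklore] -/
theorem not_summable_of_floor {x : ℕ → ℝ} {c L : ℝ} (hc : 0 < c) (hL : 1 ≤ L) (hx : ∀ j, 1 ≤ j → c ≤ x j) :
    ¬ Summable (fun j => L ^ j * x j) := by
  intro hs
  have ht := hs.tendsto_atTop_zero
  rw [Metric.tendsto_atTop] at ht
  obtain ⟨N, hN⟩ := ht c hc
  have h := hN (N + 1) (by omega)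
  rw [Real.dist_eq, sub_zero] at h
  have hxN : c ≤ x (N + 1) := hx (N + 1) (by omega)
  have hLN : 1 ≤ L ^ (N + 1) := one_le_pow₀ hL
  have hpos : 0 ≤ x (N + 1) := hc.le.trans hxN
  have : c ≤ L ^ (N + 1) * x (N + 1) := by nlinarith
  have habs : L ^ (N + 1) * x (N + 1) ≤ |L ^ (N + 1) * x (N + 1)| := le_abs_self _
  linarith

/-- By contrast, a geometric ledger IS summable against the count whenever the per-level ratio is `< 1`:
`Σ_j L^j·(A·ρ^j)` converges for `0 ≤ Lρ < 1` (on the road `ρ = r(1+η) ≍ L^{−2}`, `L·ρ ≍ L^{−1}`). [folklore] -/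
theorem summable_of_geometric {A L ρ : ℝ} (hL : 0 ≤ L) (hρ : 0 ≤ ρ) (hLρ : L * ρ < 1) :
    Summable (fun j => L ^ j * (A * ρ ^ j)) := by
  have h := (summable_geometric_of_lt_one (mul_nonneg hL hρ) hLρ).mul_left A
  refine h.congr fun j => ?_
  rw [mul_pow]; ring

end Summit.QuantumFields.BalabanUV.T4Continuum.CovariantMeanBirthLedger

end
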